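import Summits.HodgeConjecture.HodgeConjecture.Theses.EndoscopicMiddleDegree
import Summits.HodgeConjecture.HodgeConjecture.Theorems.EndoscopicMiddleDegreeIsotypicMiddleClassesAlgebraicStubCorrActionAlgebraic
import Summits.HodgeConjecture.HodgeConjecture.Theorems.EndoscopicMiddleDegreeOrthogonalEnvelopedRationalFitting
import Literature.AlgebraicGeometry.HodgeTheory.ComplexGysinCorrespondence
import Literature.AlgebraicGeometry.HodgeTheory.HodgeClassOfMorphismDuality
import Literature.AlgebraicGeometry.HodgeTheory.HodgeSectionRestrictionPairing
import Literature.AlgebraicGeometry.HodgeTheory.RationalClassesRingChange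
import Literature.AlgebraicGeometry.HodgeTheory.RationalLattice
import HarnessLib

/-!
# Crux `IsotypicMiddleClassesAlgebraic` (stmt-HodgeConjecture-14301), line
`virtual-lefschetz-noncongruence` — stub `stub_detectionCriterion` (S4, the rank count over `ℚ`)

For `X` smooth projective of dimension `2n` (`n = m + 1`) and an algebraic self-correspondence
`γ ∈ N^{2n} H^{4n}((X ⊗ X)(ℂ); ℂ)` whose action `P = γ_*` on `H = H^{2n}(X(ℂ); ℂ)` preserves
rational classes and is IDEMPOTENT: if every non-zero rational class `c'` which is cup-orthogonal
to every RATIONAL class of `ker P` has `c' ∪ a ≠ 0` for some algebraic `a`, then every rational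
`P`-fixed class is algebraic (`stub_detectionCriterion`).

PROOF (linear algebra over `ℚ`; no Hodge theory and no perfect pairing are needed). Descend along
the injective change of coefficients `ι : V = H^{2n}(X(ℂ); ℚ) → H`, whose image is the set of
rational classes: `P ∘ ι = ι ∘ P_ℚ` (`ratFit_exists_descent`) with `P_ℚ` idempotent; the cup
product commutes with `ι` (`ringChange_cupProduct`); and `ι u ∪ ι p = 0` in `H^{4n}(X(ℂ); ℂ)` iff
the RATIONAL cup pairing `b(u, p) = ⟨u ∪ p, [X(ℂ)]_ν⟩ ∈ ℚ` vanishes (`ν` a `ℚ`-orientation; top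
classes are detected by the fundamental class, `top_eq_zero_of_kroneckerPairing_eq_zero`). Let
`A = ι⁻¹(Nⁿ) ≤ V`; it is `P_ℚ`-stable because `P(Nⁿ) ⊆ Nⁿ` (landed `stub_corrActionAlgebraic`,
fed with the route support `CupProductAlgebraic`), and since `Nⁿ` is the `ℂ`-span of its
rational classes (`supportedClasses_le_span_isRationalClass`) the hypothesis descends to: every
`u ≠ 0` in `W' = {u ∈ V : b(u, ker P_ℚ) = 0}` has `b(u, a) ≠ 0` for some `a ∈ A`. The abstract
rank count `mem_of_forall_orthogonal_ker_detected` concludes: with `K = ker P_ℚ`,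
`W = Im P_ℚ = {fixed vectors}`, `A' = A ⊓ W`: (1) `dim W' ≥ dim V - dim K = dim W` (`W'` is the
kernel of `V → K^*`; rank–nullity twice); (2) `u ↦ b(u, –)|_{A'}` is injective on `W'` (for
`a ∈ A`, `a - P_ℚ a ∈ K` and `P_ℚ a ∈ A'`, so `b(u, P_ℚ a) = b(u, a) ≠ 0`), whence
`dim W' ≤ dim A'`; (3) `A' ≤ W` and `dim W ≤ dim A'` force `A' = W`, so every fixed vector lies
in `A`.
-/

noncomputable section

-- `Summit.HodgeConjecture.HodgeConjecture.Theorems` is the mandated namespace (single-problem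
-- summit: Problem = Summit), flagged by `linter.dupNamespace`; restated for stand-alone elaboration.
set_option linter.dupNamespace false

open CategoryTheory MonoidalCategory CartesianMonoidalCategory AlgebraicGeometry
open Literature.AlgebraicGeometry Literature.AlgebraicGeometry.HodgeTheory
open Literature.AlgebraicGeometry.Motives
open Literature.AlgebraicGeometry.ShimuraVarieties Literature.AlgebraicTopology.SingularHomology
open Summit.HodgeConjecture.HodgeConjecture.Theses

namespace Summit.HodgeConjecture.HodgeConjecture.Theorems

/-- **Detection criterion, abstract form (linear algebra over a field).** Let `P` be an idempotent
endomorphism of a finite-dimensional `F`-space `V`, `b` a bilinear form on `V`, and `A ≤ V` a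
`P`-stable subspace. If every `u ≠ 0` which is `b`-orthogonal to `ker P` has `b u a ≠ 0` for some
`a ∈ A`, then every `P`-fixed vector lies in `A`. (With `K = ker P`, `W = Im P`, `A' = A ⊓ W` and
`W' = {u : b(u, K) = 0}`: `dim W = dim V - dim K ≤ dim W'` by rank–nullity for `V → K^*` and for
`P`; `u ↦ b(u, –)|_{A'}` is injective on `W'` since `a - P a ∈ K` and `P a ∈ A'` for `a ∈ A`, so
`dim W' ≤ dim A'`; and `A' ≤ W`, so `A' = W`.) [folklore] -/
theorem mem_of_forall_orthogonal_ker_detected {F V : Type*} [Field F] [AddCommGroup V]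
    [Module F V] [FiniteDimensional F V] (P : V →ₗ[F] V) (hP : ∀ v, P (P v) = P v)
    (b : V →ₗ[F] V →ₗ[F] F) (A : Submodule F V) (hA : ∀ a ∈ A, P a ∈ A)
    (hdet : ∀ u : V, u ≠ 0 → (∀ p, P p = 0 → b u p = 0) → ∃ a ∈ A, b u a ≠ 0)
    {c : V} (hc : P c = c) : c ∈ A := by
  -- the kernel `K` and the fixed space `W = range P = {v | P v = v}` of the idempotent `P`
  set K : Submodule F V := LinearMap.ker P
  set W : Submodule F V := LinearMap.range P
  have hWmem : ∀ v, v ∈ W ↔ P v = v := fun v ↦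
    ⟨fun ⟨w, hw⟩ ↦ by rw [← hw, hP], fun h ↦ ⟨v, h⟩⟩
  -- the fixed vectors lying in `A`
  set A' : Submodule F V := A ⊓ W
  -- the `b`-orthogonal `W'` of the kernel, as the kernel of `V → K^*`
  set ψ : V →ₗ[F] K →ₗ[F] F := b.compl₂ K.subtype with hψdef
  set W' : Submodule F V := LinearMap.ker ψ
  have hW'mem : ∀ u, u ∈ W' → ∀ p, P p = 0 → b u p = 0 := by
    intro u hu p hp
    have h := LinearMap.congr_fun (LinearMap.mem_ker.1 hu) ⟨p, hp⟩
    rwa [hψdef, LinearMap.compl₂_apply, LinearMap.zero_apply, Submodule.subtype_apply] at h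
  -- (1) `finrank W ≤ finrank W'` (rank–nullity for `ψ` and for `P`; `range ψ ≤ K^*`)
  have h1 : Module.finrank F W ≤ Module.finrank F W' := by
    have hψrn : Module.finrank F (LinearMap.range ψ) + Module.finrank F W' = Module.finrank F V :=
      LinearMap.finrank_range_add_finrank_ker ψ
    have hPrn : Module.finrank F W + Module.finrank F K = Module.finrank F V :=
      LinearMap.finrank_range_add_finrank_ker P
    have hrange : Module.finrank F (LinearMap.range ψ) ≤ Module.finrank F K :=
      (Submodule.finrank_le _).trans Subspace.dual_finrank_eq.le
    omega
  -- (2) `finrank W' ≤ finrank A'`: `u ↦ b(u, –)|_{A'}` is injective on `W'`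
  have h2 : Module.finrank F W' ≤ Module.finrank F A' := by
    set Φ : W' →ₗ[F] A' →ₗ[F] F := (b.compl₂ A'.subtype).comp W'.subtype
    have hΦ : Function.Injective Φ := by
      refine (injective_iff_map_eq_zero Φ).2 fun u hΦu ↦ ?_
      by_contra hne
      have hu0 : (u : V) ≠ 0 := fun h ↦ hne (Subtype.ext h)
      obtain ⟨a, haA, hba⟩ := hdet u hu0 (hW'mem u u.2)
      have hPa : P a ∈ A' := ⟨hA a haA, (hWmem _).2 (hP a)⟩
      have hK : P (a - P a) = 0 := by rw [map_sub, hP, sub_self]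
      have hb0 : b u (a - P a) = 0 := hW'mem u u.2 _ hK
      have hΦa : Φ u ⟨P a, hPa⟩ = b u (P a) := rfl
      rw [hΦu, LinearMap.zero_apply] at hΦa
      rw [map_sub, ← hΦa, sub_zero] at hb0
      exact hba hb0
    exact (LinearMap.finrank_le_finrank_of_injective hΦ).trans Subspace.dual_finrank_eq.le
  -- (3) `A' ≤ W` with `finrank W ≤ finrank A'`: `A' = W ∋ c`
  have h3 : A' ≤ W := inf_le_right
  have hAW : A' = W :=
    Submodule.eq_of_le_of_finrank_eq h3 (le_antisymm (Submodule.finrank_mono h3) (h1.trans h2))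
  have hcW : c ∈ W := (hWmem c).2 hc
  rw [← hAW] at hcW
  exact hcW.1

/-- **Stub S4 (`stub_detectionCriterion`) of line `virtual-lefschetz-noncongruence` — plain
detection of the classes cup-orthogonal to the rational kernel forces algebraicity of the fixed
space.** For `X` smooth projective of dimension `2n` (`n = m + 1`), an algebraic `γ` whose action
`P = γ_*` preserves rational classes and is idempotent: if every non-zero rational `c'` with
`c' ∪ x = 0` for all RATIONAL `x ∈ ker P` has `c' ∪ a ≠ 0` for some algebraic `a`, then every
rational `P`-fixed class `c` is algebraic. Descent to `H^{2n}(X(ℂ); ℚ)` and the abstract rank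
count `mem_of_forall_orthogonal_ker_detected` (module docstring); the route support
`CupProductAlgebraic` enters through `P(Nⁿ) ⊆ Nⁿ` (`stub_corrActionAlgebraic`).
[cite: VoisinHodgeI2002, §7.1.1] [cite: HatcherAT2002, §3.3 Thm. 3.26] -/
theorem stub_detectionCriterion (h9 : EndoscopicMiddleDegree.CupProductAlgebraic)
    (μ : OrientationFamily) (hμ : μ.HasPoincareDuality) (m : ℕ) (X : SchemeOver ℂ)
    (hX : IsSmoothProjective (2 * (m + 1)) X)
    (γ : complexBetti (X ⊗ X) (2 * (2 * (m + 1))))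
    (hγ : γ ∈ algebraicClasses (X ⊗ X) (2 * (m + 1)))
    (hPrat : ∀ β, IsRationalClass β → IsRationalClass (corrAction μ hX hX
      (rfl : 2 * (m + 1) + 2 * (2 * (m + 1)) = 2 * (m + 1) + 2 * (2 * (m + 1))) γ β))
    (hPidem : ∀ β, corrAction μ hX hX
        (rfl : 2 * (m + 1) + 2 * (2 * (m + 1)) = 2 * (m + 1) + 2 * (2 * (m + 1))) γ
        (corrAction μ hX hX
          (rfl : 2 * (m + 1) + 2 * (2 * (m + 1)) = 2 * (m + 1) + 2 * (2 * (m + 1))) γ β) =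
      corrAction μ hX hX
        (rfl : 2 * (m + 1) + 2 * (2 * (m + 1)) = 2 * (m + 1) + 2 * (2 * (m + 1))) γ β)
    (hdet : ∀ c' : complexBetti X (2 * (m + 1)), IsRationalClass c' → c' ≠ 0 →
      (∀ x : complexBetti X (2 * (m + 1)), IsRationalClass x →
        corrAction μ hX hX
          (rfl : 2 * (m + 1) + 2 * (2 * (m + 1)) = 2 * (m + 1) + 2 * (2 * (m + 1))) γ x = 0 →
        cupProduct (two_mul_add_two_mul (m + 1) (m + 1)) c' x = 0) →
      ∃ a ∈ algebraicClasses X (m + 1), cupProduct (two_mul_add_two_mul (m + 1) (m + 1)) c' a ≠ 0)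
    (c : complexBetti X (2 * (m + 1))) (hc : IsRationalClass c)
    (hPc : corrAction μ hX hX
      (rfl : 2 * (m + 1) + 2 * (2 * (m + 1)) = 2 * (m + 1) + 2 * (2 * (m + 1))) γ c = c) :
    c ∈ algebraicClasses X (m + 1) := by
  haveI : Module.Finite ℚ (singularCohomology ℚ ℚ (ComplexPoints X) (2 * (m + 1))) :=
    finite_singularCohomology_rat_complexPoints hX _
  -- descent of `P` along `ι : H^{2n}(X(ℂ); ℚ) → H^{2n}(X(ℂ); ℂ)` to an idempotent `Pq`
  obtain ⟨Pq, hPq⟩ :=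
    Cruxes.OrthogonalEnveloped.MiddleInvolutionPurity.ratFit_exists_descent _ hPrat
  have hPqidem : ∀ v, Pq (Pq v) = Pq v := fun v ↦
    ringChange_rat_injective (by rw [hPq, hPq, hPidem])
  -- a rational orientation `ν` and the rational cup pairing `b(u, p) = ⟨u ∪ p, [X(ℂ)]_ν⟩ ∈ ℚ`
  obtain ⟨ν⟩ := Motives.ComplexPoints.isOrientableOver ℚ hX
  have had : 2 * (m + 1) + 2 * (m + 1) = 2 * (2 * (m + 1)) := by ring
  -- `ι u ∪ ι p = 0` iff `b(u, p) = 0`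
  have htrans : ∀ u p : singularCohomology ℚ ℚ (ComplexPoints X) (2 * (m + 1)),
      cupProduct (two_mul_add_two_mul (m + 1) (m + 1))
          (singularCohomology.ringChange (algebraMap ℚ ℂ) (ComplexPoints X) (2 * (m + 1)) u)
          (singularCohomology.ringChange (algebraMap ℚ ℂ) (ComplexPoints X) (2 * (m + 1)) p) = 0 ↔
        cupPairing ν had u p = 0 := by
    intro u p
    rw [← singularCohomology.ringChange_cupProduct, ringChange_rat_eq_zero_iff,
      cupProduct_eq_zero_iff_of_degree_eq (two_mul_add_two_mul (m + 1) (m + 1)) had u p,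
      cupPairing_apply]
    exact ⟨fun h ↦ by rw [h, map_zero, LinearMap.zero_apply],
      top_eq_zero_of_kroneckerPairing_eq_zero hX ν⟩
  -- the rational structure `A = ι⁻¹(Nⁿ)` of the algebraic classes, stable under `Pq`
  let A : Submodule ℚ (singularCohomology ℚ ℚ (ComplexPoints X) (2 * (m + 1))) :=
    { carrier := {u | singularCohomology.ringChange (algebraMap ℚ ℂ) (ComplexPoints X)
        (2 * (m + 1)) u ∈ algebraicClasses X (m + 1)}
      add_mem' := fun {u v} hu hv ↦ by
        change singularCohomology.ringChange (algebraMap ℚ ℂ) (ComplexPoints X) (2 * (m + 1))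
          (u + v) ∈ algebraicClasses X (m + 1)
        rw [map_add]
        exact Submodule.add_mem _ hu hv
      zero_mem' := by
        change singularCohomology.ringChange (algebraMap ℚ ℂ) (ComplexPoints X) (2 * (m + 1)) 0 ∈
          algebraicClasses X (m + 1)
        rw [map_zero]
        exact Submodule.zero_mem _
      smul_mem' := fun q u hu ↦ by
        change singularCohomology.ringChange (algebraMap ℚ ℂ) (ComplexPoints X) (2 * (m + 1))
          (q • u) ∈ algebraicClasses X (m + 1)
        rw [ringChange_ratCast_smul]
        exact Submodule.smul_mem _ _ hu }
  have hAmem : ∀ u, u ∈ A ↔ singularCohomology.ringChange (algebraMap ℚ ℂ) (ComplexPoints X)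
      (2 * (m + 1)) u ∈ algebraicClasses X (m + 1) := fun u ↦ Iff.rfl
  have hA : ∀ a ∈ A, Pq a ∈ A := fun a ha ↦ by
    rw [hAmem, hPq]
    exact stub_corrActionAlgebraic h9 μ hμ m X hX γ hγ _ ((hAmem a).1 ha)
  -- the detection hypothesis descends
  have hdetQ : ∀ u : singularCohomology ℚ ℚ (ComplexPoints X) (2 * (m + 1)), u ≠ 0 →
      (∀ p, Pq p = 0 → cupPairing ν had u p = 0) → ∃ a ∈ A, cupPairing ν had u a ≠ 0 := by
    intro u hu0 horth
    have hιu0 :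
        singularCohomology.ringChange (algebraMap ℚ ℂ) (ComplexPoints X) (2 * (m + 1)) u ≠ 0 :=
      fun h ↦ hu0 ((ringChange_rat_eq_zero_iff u).1 h)
    obtain ⟨a, ha, hne⟩ := hdet _ (isRationalClass_ringChange u) hιu0 fun x hx hPx ↦ by
      obtain ⟨p, rfl⟩ := hx.exists_ringChange_eq
      rw [← hPq, ringChange_rat_eq_zero_iff] at hPx
      exact (htrans u p).2 (horth p hPx)
    -- `Nⁿ` is the `ℂ`-span of its rational classes, so some RATIONAL algebraic class detects `ι u`
    by_contra hall
    push Not at hall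
    apply hne
    refine LinearMap.mem_ker.1 ((Submodule.span_le (p := LinearMap.ker
      (cupProduct (two_mul_add_two_mul (m + 1) (m + 1))
        (singularCohomology.ringChange (algebraMap ℚ ℂ) (ComplexPoints X) (2 * (m + 1)) u)))).2
      ?_ (supportedClasses_le_span_isRationalClass hX (2 * (m + 1)) (m + 1) ha))
    rintro y ⟨hyQ, hyN⟩
    obtain ⟨p, rfl⟩ := hyQ.exists_ringChange_eq
    exact LinearMap.mem_ker.2 ((htrans u p).2 (hall p ((hAmem p).2 hyN)))
  -- conclude by the abstract rank count
  obtain ⟨c₀, rfl⟩ := hc.exists_ringChange_eq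
  have hc₀ : Pq c₀ = c₀ := ringChange_rat_injective (by rw [hPq]; exact hPc)
  exact (hAmem c₀).1
    (mem_of_forall_orthogonal_ker_detected Pq hPqidem (cupPairing ν had) A hA hdetQ hc₀)

end Summit.HodgeConjecture.HodgeConjecture.Theorems

end
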